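import Summits.HubbardSuperconductivity.HubbardSuperconductivity.Theorems.AnisotropyChordTransferTolerance

/-!
# Route `AnisotropyChord` / H0 rotor rung, route (1): the FLOOR FORM of the tolerance theorem — BEC on the first `k`
# sectors needs only a tower-fidelity FLOOR `F_j ≥ f₀ > 0`, not a small defect (theory seat `hubbard-h0-rotor-theory-1`
# g16, memo ROTOR-THEORY-16 §204)
(Verbatim port of the theory seat `hubbard-h0-rotor-theory-1` file `cycle16/lean/PartN16.lean`, sha16 40c0faa4a7570ab7, by the prover seat
`hubbard-h0-rotor-p1` g18: tree namespace, linter option and docstring tags only; no new mathematics.)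

The landed TRANSFER inequality `⟨S⃗²⟩_{ψ_{j+1}} ≥ ⟨S⃗²⟩_{ψ_j} − (1 − F_j)‖S⁺ψ_j‖²` (`spinSquaredTransfer_holds`) together with
`‖S⁺ψ_j‖² = ⟨S⃗²⟩_{ψ_j} − j² − j ≤ ⟨S⃗²⟩_{ψ_j}` (`raiseNormSq_eq_totalSpinSq`) is MULTIPLICATIVE: `⟨S⃗²⟩_{ψ_{j+1}} ≥ F_j · ⟨S⃗²⟩_{ψ_j}`.
Hence a FLOOR `F_j ≥ f₀` on the links `j < k` and the half-filling anchor `⟨S⃗²⟩_{ψ_0} = ‖S⁻ψ_0‖² ≥ c₀|V|²` give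
`‖S⁻ψ_j‖² ≥ f₀^j c₀ |V|² − j²`, i.e. BEC on the first `k` sectors with floor `f₀^k c₀ / 2` — for ANY `f₀ ∈ (0,1]`, whereas the
additive tolerance form `condensateOnFirstSectors_of_fidelityDefect` needs the defect `1 − F_j ≤ δ` with `kδ < c₀`.

* `TowerFidelityFloor Δ f₀ k` — eventually in `L`, `towerFidelity ψ_j ψ_{j+1} ≥ f₀` on the links `j < k` (the WEAKEST residual of
  route (1): `F_j` is the fraction of the `K = 0` particle-addition weight of `ψ_j` carried by the ground state `ψ_{j+1}`);
* `totalSpinSq_succ_ge_fidelity_mul` — one link, multiplicative: `F · ⟨S⃗²⟩_b(j) ≤ ⟨S⃗²⟩_a(j+1)`;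
* **`condensateOnFirstSectors_of_fidelityFloor`** — `HalfFillingAnchor Δ c₀` + `TowerFidelityFloor Δ f₀ k`, `0 < f₀` ⇒
  `CondensateOnFirstSectors Δ k` (any `Δ`); `…_xy_…` at `Δ = 0` with the KLS anchor of the tree.

Kinematic bookkeeping (no Hamiltonian input beyond the Perron amplitudes). [folklore]
-/

set_option linter.dupNamespace false
set_option autoImplicit false

noncomputable section

open Finset Filter Topology
open Literature.MathematicalPhysics.QuantumLattice Literature.Probability.LatticeModels
open Summit.HubbardSuperconductivity.HubbardSuperconductivity.Theorems.AnisotropyChord.InsertionEntropy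
open Summit.HubbardSuperconductivity.HubbardSuperconductivity.Theorems.AnisotropyChord.Tower

namespace Summit.HubbardSuperconductivity.HubbardSuperconductivity.Theorems.AnisotropyChord.Transfer

/-- **HYPOTHESIS (tower-fidelity FLOOR `f₀` on the first `k` links):** eventually in `L`, for `j < k` and the Perron amplitudes
`b` (sector `j`), `a` (sector `j + 1`): `f₀ ≤ towerFidelity b a` (`towerFidelity b a = ⟨a, S⁺b⟩²/‖S⁺b‖²` = the ground-state share
of the `K = 0` addition weight of `b`).  Spin-wave value `F_j → 1` (`d = 2`); `d = 1` free-fermion value `F_0 → F* ∈ (0,1)`.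
[conjecture: theory seat hubbard-h0-rotor-theory-1, cycle 16, memo ROTOR-THEORY-16 §204 — weakest residual of route (1); OPEN] -/
def TowerFidelityFloor (Δ f₀ : ℝ) (k : ℕ) : Prop :=
  ∀ᶠ L : ℕ in atTop, ∀ [NeZero L], ∀ j : ℕ, j < k →
    ∀ b a : TensorIndex (TorusSite 2 L) 2 → ℝ,
      IsPerronSectorGroundAmplitude L Δ (j : ℝ) b → IsPerronSectorGroundAmplitude L Δ ((j : ℝ) + 1) a →
        f₀ ≤ towerFidelity b a

variable {L : ℕ} [NeZero L]

/-- **ONE LINK, MULTIPLICATIVE:** for a Perron amplitude `b` of an integer sector `j ≥ 0` and any unit `a`: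
`towerFidelity b a · ⟨S⃗²⟩_b(j) ≤ ⟨S⃗²⟩_a(j+1)` (TRANSFER + `‖S⁺b‖² ≤ ⟨S⃗²⟩_b(j)`). [folklore] -/
theorem totalSpinSq_succ_ge_fidelity_mul {Δ : ℝ} {j : ℕ} {b a : TensorIndex (TorusSite 2 L) 2 → ℝ}
    (hb : IsPerronSectorGroundAmplitude L Δ (j : ℝ) b) (ha : ∑ σ, a σ ^ 2 = 1) :
    towerFidelity b a
        * Summit.HubbardSuperconductivity.HubbardSuperconductivity.Theorems.AnisotropyChord.Tower.totalSpinSq b (j : ℝ)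
      ≤ Summit.HubbardSuperconductivity.HubbardSuperconductivity.Theorems.AnisotropyChord.Tower.totalSpinSq a ((j : ℝ) + 1) := by
  have hR := raiseNormSq_eq_totalSpinSq hb
  have hj : (0 : ℝ) ≤ j := Nat.cast_nonneg _
  have hR0 : 0 ≤ raiseNormSq b := Finset.sum_nonneg fun σ _ => sq_nonneg _
  have hF0 : 0 ≤ towerFidelity b a := towerFidelity_nonneg b a
  have hF1 : towerFidelity b a ≤ 1 := by have := towerFidelity_le b a; rw [ha] at this; exact this
  rcases eq_or_lt_of_le hR0 with hz | hpos
  · -- `S⁺b = 0`: the fidelity is the junk value `0`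
    have hF : towerFidelity b a = 0 := by unfold towerFidelity; rw [← hz, div_zero]
    rw [hF, zero_mul]
    -- `⟨S⃗²⟩_a(j+1) = ‖S⁻a‖² + (j+1)² − (j+1) ≥ 0`
    unfold Summit.HubbardSuperconductivity.HubbardSuperconductivity.Theorems.AnisotropyChord.Tower.totalSpinSq
    have : 0 ≤ lowerNormSq a := Finset.sum_nonneg fun σ _ => sq_nonneg _
    nlinarith
  · have htr := spinSquaredTransfer_holds L (j : ℝ) b a hb.sector hb.unit ha hpos
    -- `(1 − F)‖S⁺b‖² ≤ (1 − F)⟨S⃗²⟩_b(j)` since `‖S⁺b‖² = ⟨S⃗²⟩_b(j) − j² − j`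
    have hRT : raiseNormSq b
        ≤ Summit.HubbardSuperconductivity.HubbardSuperconductivity.Theorems.AnisotropyChord.Tower.totalSpinSq b (j : ℝ) := by
      rw [hR]; nlinarith
    have h1 : (1 - towerFidelity b a) * raiseNormSq b
        ≤ (1 - towerFidelity b a)
          * Summit.HubbardSuperconductivity.HubbardSuperconductivity.Theorems.AnisotropyChord.Tower.totalSpinSq b (j : ℝ) :=
      mul_le_mul_of_nonneg_left hRT (by linarith)
    nlinarith [htr, h1]

/-- **FLOOR FORM (BEC end):** half-filling anchor `c₀` + a tower-fidelity FLOOR `f₀ > 0` on the first `k` links ⇒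
`CondensateOnFirstSectors Δ k`, with the explicit floor `f₀^k c₀ / 2` on each sector `j ≤ k`. Any anisotropy `Δ`.
[conjecture: theory seat hubbard-h0-rotor-theory-1, cycle 16, memo ROTOR-THEORY-16 §204; Lean proof here] -/
theorem condensateOnFirstSectors_of_fidelityFloor {Δ c₀ f₀ : ℝ} {k : ℕ} (hc₀ : 0 < c₀) (hf₀ : 0 < f₀)
    (hA : HalfFillingAnchor Δ c₀) (h : TowerFidelityFloor Δ f₀ k) :
    CondensateOnFirstSectors Δ k := by
  intro j hj
  refine ⟨f₀ ^ k * c₀ / 2, by positivity, ?_⟩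
  -- eventually `k² ≤ (f₀^k c₀ / 2) |V|²`
  have hT : ∀ᶠ L : ℕ in atTop, (k : ℝ) ^ 2 ≤ f₀ ^ k * c₀ / 2 * (L : ℝ) ^ 2 ∧ 2 * k ≤ L := by
    have hc : 0 < f₀ ^ k * c₀ / 2 := by positivity
    filter_upwards [eventually_ge_atTop (⌈(k : ℝ) ^ 2 / (f₀ ^ k * c₀ / 2)⌉₊ + 1), eventually_ge_atTop (2 * k)]
      with L hL hL2
    refine ⟨?_, hL2⟩
    have h1 : (k : ℝ) ^ 2 / (f₀ ^ k * c₀ / 2) ≤ L := by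
      have h3 := Nat.le_ceil ((k : ℝ) ^ 2 / (f₀ ^ k * c₀ / 2))
      have h2 : ((⌈(k : ℝ) ^ 2 / (f₀ ^ k * c₀ / 2)⌉₊ + 1 : ℕ) : ℝ) ≤ L := by exact_mod_cast hL
      push_cast at h2; linarith
    have hL1 : (1 : ℝ) ≤ L := by exact_mod_cast (show 1 ≤ L by omega)
    rw [div_le_iff₀ hc] at h1
    have hLL : (L : ℝ) ≤ (L : ℝ) ^ 2 := by nlinarith
    nlinarith [h1, mul_le_mul_of_nonneg_left hLL hc.le]
  filter_upwards [hA, h, hT] with L hAL hL hTL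
  intro _ a ha
  set V : ℝ := (Fintype.card (TorusSite 2 L) : ℝ) with hVdef
  have hV : V = (L : ℝ) ^ 2 := by
    rw [hVdef, Fintype.card_fun, ZMod.card, Fintype.card_fin]; push_cast; ring
  have hVpos : 0 < V := by rw [hVdef]; exact_mod_cast Fintype.card_pos
  -- the sector-0 Perron amplitude (L is even) and the chain ψ_0, …, ψ_j = a
  obtain ⟨a₀, ha₀⟩ := exists_perron_zero_of_even Δ (even_of_perron_nat ha)
  have hexN : ∀ i : ℕ, i ≤ j → ∃ b : TensorIndex (TorusSite 2 L) 2 → ℝ,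
      IsPerronSectorGroundAmplitude L Δ (i : ℝ) b := fun i hi =>
    exists_perron_nat ha₀ i (le_trans (by omega) (le_trans hTL.2 (Nat.le_self_pow two_ne_zero L)))
  choose! ψ hψ using hexN
  have hψ0 : IsPerronSectorGroundAmplitude L Δ 0 (ψ 0) := by
    have := hψ 0 (Nat.zero_le _); rwa [Nat.cast_zero] at this
  have ea : a = ψ j := perron_eq ha (hψ j le_rfl)
  -- anchor: ⟨S⃗²⟩_{ψ_0}(0) = ‖S⁻ψ_0‖² ≥ c₀ V²
  have hanchor : c₀ * V ^ 2
      ≤ Summit.HubbardSuperconductivity.HubbardSuperconductivity.Theorems.AnisotropyChord.Tower.totalSpinSq (ψ 0) 0 := by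
    have h0 := hAL (ψ 0) hψ0
    unfold condensateDensity at h0
    rw [← hVdef, le_div_iff₀ (by positivity)] at h0
    unfold Summit.HubbardSuperconductivity.HubbardSuperconductivity.Theorems.AnisotropyChord.Tower.totalSpinSq
    nlinarith [h0]
  -- multiplicative induction: ⟨S⃗²⟩_{ψ_i}(i) ≥ f₀^i c₀ V²
  have key : ∀ i, i ≤ j → f₀ ^ i * (c₀ * V ^ 2)
      ≤ Summit.HubbardSuperconductivity.HubbardSuperconductivity.Theorems.AnisotropyChord.Tower.totalSpinSq (ψ i) (i : ℝ) := by
    intro i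
    induction i with
    | zero => intro _; simpa using hanchor
    | succ i ih =>
      intro hi
      have ih' := ih (by omega)
      have hψi := hψ i (by omega)
      have hψi1 : IsPerronSectorGroundAmplitude L Δ ((i : ℝ) + 1) (ψ (i + 1)) := by
        have := hψ (i + 1) hi; push_cast at this; exact this
      have hfl : f₀ ≤ towerFidelity (ψ i) (ψ (i + 1)) := hL i (by omega) (ψ i) (ψ (i + 1)) hψi hψi1
      have hmul := totalSpinSq_succ_ge_fidelity_mul hψi hψi1.unit
      have hT0 : 0 ≤ Summit.HubbardSuperconductivity.HubbardSuperconductivity.Theorems.AnisotropyChord.Tower.totalSpinSq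
          (ψ i) (i : ℝ) := le_trans (by positivity) ih'
      have h2 : f₀ * (f₀ ^ i * (c₀ * V ^ 2))
          ≤ towerFidelity (ψ i) (ψ (i + 1))
            * Summit.HubbardSuperconductivity.HubbardSuperconductivity.Theorems.AnisotropyChord.Tower.totalSpinSq (ψ i) (i : ℝ) :=
        mul_le_mul hfl ih' (by positivity) (le_trans hf₀.le hfl)
      push_cast at hmul ⊢
      calc f₀ ^ (i + 1) * (c₀ * V ^ 2) = f₀ * (f₀ ^ i * (c₀ * V ^ 2)) := by ring
        _ ≤ _ := le_trans h2 hmul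
  have hmain := key j le_rfl
  -- ⟨S⃗²⟩_{ψ_j}(j) = ‖S⁻ψ_j‖² + j² − j
  have hlow : lowerNormSq (ψ j)
      = Summit.HubbardSuperconductivity.HubbardSuperconductivity.Theorems.AnisotropyChord.Tower.totalSpinSq (ψ j) (j : ℝ)
        - (j : ℝ) ^ 2 + j := lowerNormSq_eq_totalSpinSq (j : ℝ) (ψ j)
  rw [ea]
  unfold condensateDensity
  rw [← hVdef, le_div_iff₀ (by positivity)]
  have hjk : (j : ℝ) ≤ k := by exact_mod_cast hj
  have hj0 : (0 : ℝ) ≤ j := Nat.cast_nonneg _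
  have hk2 : (k : ℝ) ^ 2 ≤ f₀ ^ k * c₀ / 2 * V := by rw [hV]; exact hTL.1
  have hV1 : 1 ≤ V := by
    rw [hV]; have : (1 : ℝ) ≤ L := by exact_mod_cast Nat.one_le_iff_ne_zero.mpr (NeZero.ne L)
    nlinarith
  -- `f₀^k ≤ f₀^j` for `f₀ ≤ 1`; a floor `f₀ > 1` is contradictory as soon as one link exists (`F ≤ 1`), and moot for `k = 0`.
  rcases le_or_gt f₀ 1 with hle | hgt
  · have hpow : f₀ ^ k ≤ f₀ ^ j := pow_le_pow_of_le_one hf₀.le hle hj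
    have hc2 : 0 ≤ c₀ * V ^ 2 := by positivity
    nlinarith [hmain, hlow, hpow, mul_le_mul_of_nonneg_right hpow hc2, hk2, sq_nonneg (j : ℝ)]
  · -- f₀ > 1: if k = 0 then j = 0 and f₀^0 = 1; else link 0 exists and F ≤ 1 < f₀ contradicts the floor
    rcases Nat.eq_zero_or_pos k with hk0 | hkpos
    · subst hk0
      have hj0' : j = 0 := by omega
      subst hj0'
      simp only [pow_zero, one_mul, Nat.cast_zero] at hmain hlow ⊢
      nlinarith [hmain, hlow]
    · exfalso
      -- sector 1 Perron amplitude exists since 2 ≤ 2k ≤ L ≤ L²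
      obtain ⟨b₁, hb₁⟩ := exists_perron_nat ha₀ 1 (le_trans (by omega) (le_trans hTL.2 (Nat.le_self_pow two_ne_zero L)))
      have hfl := hL 0 hkpos a₀ b₁ (by simpa using ha₀) (by simpa using hb₁)
      have hF1 : towerFidelity a₀ b₁ ≤ 1 := by have := towerFidelity_le a₀ b₁; rw [hb₁.unit] at this; exact this
      linarith

/-- **XY point:** for hard-core bosons on `(ℤ/L)²`, ANY tower-fidelity floor `f₀ > 0` on the first `k` links gives BEC in the
sectors `N = L²/2 + j`, `j ≤ k` (anchor = Kennedy–Lieb–Shastry, tree `halfFillingAnchor_xy`). [folklore] -/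
theorem condensateOnFirstSectors_xy_of_fidelityFloor {f₀ : ℝ} (hf₀ : 0 < f₀) (k : ℕ) (h : TowerFidelityFloor 0 f₀ k) :
    CondensateOnFirstSectors 0 k := by
  obtain ⟨c₀, hc₀, hA⟩ := halfFillingAnchor_xy
  exact condensateOnFirstSectors_of_fidelityFloor hc₀ hf₀ hA h

/-- The defect form implies the floor form: `TowerFidelityDefect Δ δ k ⇒ TowerFidelityFloor Δ (1 − δ) k`. [folklore] -/
theorem towerFidelityFloor_of_defect {Δ δ : ℝ} {k : ℕ} (h : TowerFidelityDefect Δ δ k) : TowerFidelityFloor Δ (1 - δ) k := by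
  filter_upwards [h] with L hL
  intro _ j hj b a hb ha
  have := hL j hj b a hb ha
  linarith

end Summit.HubbardSuperconductivity.HubbardSuperconductivity.Theorems.AnisotropyChord.Transfer
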